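import Summits.Ventures.QEC.CircuitDistance.DEMCheck
import HarnessLib

/-!
# The word-level simulator REPRESENTS the Pauli-frame semantics (`Rel`, `rel_run`)

Cell `qec`, experiment CDX (engine seat qec-cdx-eng-1). Proof that `DEMCheck.runW` (register words) simulates
`SyndromeCycle.run1` (frames `Qubit → Bool × Bool`) event by event: the relation `Rel` (frame bits and outcome flips agree at
bit `bitIdx i`), its preservation under ideal events (`Rel.applyEv`), fault injection (`Rel.inject`), whole simulations
(`Rel.simulate`) and the corollary `rel_run`. Nothing here changes a statement.
-/

namespace Summit.Ventures.QEC.CircuitDistance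

open Literature.InformationTheory.QuantumCodes

variable {ℓ m : ℕ}

variable [NeZero ℓ] [NeZero m]

/-! ## The simulation relation: words represent frames -/

namespace WState

/-- `x` of the written register after `setX`. -/
@[simp] theorem x_setX_self (s : WState) (r : Reg) (w : ℕ) : (s.setX r w).x r = w := by cases r <;> rfl
/-- `x` of another register after `setX`. -/
theorem x_setX_ne (s : WState) {r r' : Reg} (h : r' ≠ r) (w : ℕ) : (s.setX r w).x r' = s.x r' := by
  cases r <;> cases r' <;> first | rfl | exact absurd rfl h
/-- `z` words are untouched by `setX`. -/
@[simp] theorem z_setX (s : WState) (r r' : Reg) (w : ℕ) : (s.setX r w).z r' = s.z r' := by cases r <;> cases r' <;> rfl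
/-- `z` of the written register after `setZ`. -/
@[simp] theorem z_setZ_self (s : WState) (r : Reg) (w : ℕ) : (s.setZ r w).z r = w := by cases r <;> rfl
/-- `z` of another register after `setZ`. -/
theorem z_setZ_ne (s : WState) {r r' : Reg} (h : r' ≠ r) (w : ℕ) : (s.setZ r w).z r' = s.z r' := by
  cases r <;> cases r' <;> first | rfl | exact absurd rfl h
/-- `x` words are untouched by `setZ`. -/
@[simp] theorem x_setZ (s : WState) (r r' : Reg) (w : ℕ) : (s.setZ r w).x r' = s.x r' := by cases r <;> cases r' <;> rfl
/-- flips untouched by `setX`. -/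
@[simp] theorem mX_setX (s : WState) (r : Reg) (w : ℕ) : (s.setX r w).mX = s.mX := by cases r <;> rfl
/-- flips untouched by `setX`. -/
@[simp] theorem mZ_setX (s : WState) (r : Reg) (w : ℕ) : (s.setX r w).mZ = s.mZ := by cases r <;> rfl
/-- flips untouched by `setZ`. -/
@[simp] theorem mX_setZ (s : WState) (r : Reg) (w : ℕ) : (s.setZ r w).mX = s.mX := by cases r <;> rfl
/-- flips untouched by `setZ`. -/
@[simp] theorem mZ_setZ (s : WState) (r : Reg) (w : ℕ) : (s.setZ r w).mZ = s.mZ := by cases r <;> rfl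
/-- `x` after `setX`, by cases. -/
theorem x_setX (s : WState) (r r' : Reg) (w : ℕ) : (s.setX r w).x r' = if r' = r then w else s.x r' := by
  by_cases h : r' = r
  · subst h; simp
  · rw [if_neg h, x_setX_ne s h]
/-- `z` after `setZ`, by cases. -/
theorem z_setZ (s : WState) (r r' : Reg) (w : ℕ) : (s.setZ r w).z r' = if r' = r then w else s.z r' := by
  by_cases h : r' = r
  · subst h; simp
  · rw [if_neg h, z_setZ_ne s h]

end WState

/-- `s` REPRESENTS `st`: frame bits and outcome flips agree bitwise (bit `bitIdx i` of the register words). -/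
structure Rel (st : State ℓ m) (s : WState) : Prop where
  /-- `x`-bits -/ fx : ∀ r i, (st.frame (r, i)).1 = (s.x r).testBit (bitIdx i)
  /-- `z`-bits -/ fz : ∀ r i, (st.frame (r, i)).2 = (s.z r).testBit (bitIdx i)
  /-- `X`-outcome flips -/ hX : ∀ c i, st.mX c i = (s.mX c).testBit (bitIdx i)
  /-- `Z`-outcome flips -/ hZ : ∀ c i, st.mZ c i = (s.mZ c).testBit (bitIdx i)

omit [NeZero ℓ] [NeZero m] in
/-- The all-clear states correspond. -/
theorem Rel.init : Rel (State.init : State ℓ m) WState.init := by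
  refine ⟨?_, ?_, ?_, ?_⟩ <;> intros <;> (try cases ‹Reg›) <;> simp [State.init, WState.init, WState.x, WState.z]

omit [NeZero ℓ] [NeZero m] in
/-- Control and target registers of a layer differ. -/
theorem Layer.ctrl_ne_tgt (lay : Layer) : lay.ctrl ≠ lay.tgt := by cases lay <;> decide

/-- One ideal event preserves the representation. -/
theorem Rel.applyEv (S : SMCode ℓ m) (e : Ev) {st : State ℓ m} {s : WState} (h : Rel st s) :
    Rel (applyEv S e st) (applyEvW S e s) := by
  obtain ⟨fx, fz, hX, hZ⟩ := h
  cases e with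
  | cnot c lay =>
    have hne := Layer.ctrl_ne_tgt lay
    refine ⟨?_, ?_, ?_, ?_⟩
    · intro r i
      simp only [_root_.Summit.Ventures.QEC.CircuitDistance.applyEv, Frame.cnotLayer, applyEvW,
        WState.x_setZ, WState.x_setX]
      by_cases hb : r = lay.tgt
      · subst hb; simp [fx, Nat.testBit_xor, testBit_translateW]
      · rw [if_neg hb, if_neg hb]
        by_cases ha : r = lay.ctrl
        · subst ha; simp [fx]
        · rw [if_neg ha]; exact fx r i
    · intro r i
      simp only [_root_.Summit.Ventures.QEC.CircuitDistance.applyEv, Frame.cnotLayer, applyEvW,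
        WState.z_setZ, WState.z_setX]
      by_cases hb : r = lay.tgt
      · subst hb
        rw [if_pos rfl, if_neg (Ne.symm hne)]
        exact fz _ i
      · rw [if_neg hb]
        by_cases ha : r = lay.ctrl
        · subst ha
          simp [fz, Nat.testBit_xor, testBit_translateW, sub_neg_eq_add]
        · rw [if_neg ha, if_neg ha]; exact fz r i
    · intro c' i; simp [_root_.Summit.Ventures.QEC.CircuitDistance.applyEv, applyEvW, hX]
    · intro c' i; simp [_root_.Summit.Ventures.QEC.CircuitDistance.applyEv, applyEvW, hZ]
  | measX c =>
    refine ⟨fx, fz, ?_, hZ⟩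
    intro c' i
    simp only [_root_.Summit.Ventures.QEC.CircuitDistance.applyEv, applyEvW]
    by_cases hc : c' = c
    · simp [hc, hX, Nat.testBit_xor, fz]; rfl
    · simp [hc, hX]
  | measZ c =>
    refine ⟨fx, fz, hX, ?_⟩
    intro c' i
    simp only [_root_.Summit.Ventures.QEC.CircuitDistance.applyEv, applyEvW]
    by_cases hc : c' = c
    · simp [hc, hZ, Nat.testBit_xor, fx]; rfl
    · simp [hc, hZ]
  | initX c =>
    refine ⟨?_, ?_, hX, hZ⟩
    · intro r i; cases r <;> simp [_root_.Summit.Ventures.QEC.CircuitDistance.applyEv, applyEvW, Frame.clearReg, WState.x, fx]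
    · intro r i; cases r <;> simp [_root_.Summit.Ventures.QEC.CircuitDistance.applyEv, applyEvW, Frame.clearReg, WState.z, fz]
  | initZ c =>
    refine ⟨?_, ?_, hX, hZ⟩
    · intro r i; cases r <;> simp [_root_.Summit.Ventures.QEC.CircuitDistance.applyEv, applyEvW, Frame.clearReg, WState.x, fx]
    · intro r i; cases r <;> simp [_root_.Summit.Ventures.QEC.CircuitDistance.applyEv, applyEvW, Frame.clearReg, WState.z, fz]
  | idle c sl => exact ⟨fx, fz, hX, hZ⟩

omit [NeZero ℓ] [NeZero m] in
/-- `x`-words after `mulAt`. -/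
theorem WState.x_mulAt (s : WState) (r r' : Reg) (i : BB.Mono ℓ m) (p : P1) :
    (s.mulAt r i p).x r' = if p.1 = true ∧ r' = r then s.x r ^^^ 2 ^ bitIdx i else s.x r' := by
  rcases p with ⟨px, pz⟩
  unfold WState.mulAt
  cases px <;> cases pz <;> simp [WState.x_setX]

omit [NeZero ℓ] [NeZero m] in
/-- `z`-words after `mulAt`. -/
theorem WState.z_mulAt (s : WState) (r r' : Reg) (i : BB.Mono ℓ m) (p : P1) :
    (s.mulAt r i p).z r' = if p.2 = true ∧ r' = r then s.z r ^^^ 2 ^ bitIdx i else s.z r' := by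
  rcases p with ⟨px, pz⟩
  unfold WState.mulAt
  cases px <;> cases pz <;> simp [WState.z_setZ]

omit [NeZero ℓ] [NeZero m] in
/-- flips untouched by `mulAt`. -/
@[simp] theorem WState.mX_mulAt (s : WState) (r : Reg) (i : BB.Mono ℓ m) (p : P1) : (s.mulAt r i p).mX = s.mX := by
  rcases p with ⟨px, pz⟩; unfold WState.mulAt; cases px <;> cases pz <;> simp

omit [NeZero ℓ] [NeZero m] in
/-- flips untouched by `mulAt`. -/
@[simp] theorem WState.mZ_mulAt (s : WState) (r : Reg) (i : BB.Mono ℓ m) (p : P1) : (s.mulAt r i p).mZ = s.mZ := by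
  rcases p with ⟨px, pz⟩; unfold WState.mulAt; cases px <;> cases pz <;> simp

omit [NeZero ℓ] in
/-- `mulAt` on words vs frames. -/
theorem Rel.mulAt {st : State ℓ m} {s : WState} (h : Rel st s) (r : Reg) (i : BB.Mono ℓ m) (p : P1) :
    Rel { st with frame := st.frame.mulAt (r, i) p } (s.mulAt r i p) := by
  obtain ⟨fx, fz, hX, hZ⟩ := h
  rcases p with ⟨px, pz⟩
  refine ⟨?_, ?_, ?_, ?_⟩
  · intro r' j
    rw [WState.x_mulAt]
    simp only [Frame.mulAt, P1.mul, Prod.mk.injEq]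
    by_cases hr : r' = r
    · subst hr
      by_cases hj : j = i
      · subst hj; cases px
        · simp [fx]
        · simp [fx, Nat.testBit_xor]
      · cases px
        · simp [hj, fx]
        · simp [hj, fx, Nat.testBit_xor, testBit_two_pow_bitIdx]
    · cases px <;> simp [hr, fx]
  · intro r' j
    rw [WState.z_mulAt]
    simp only [Frame.mulAt, P1.mul, Prod.mk.injEq]
    by_cases hr : r' = r
    · subst hr
      by_cases hj : j = i
      · subst hj; cases pz
        · simp [fz]
        · simp [fz, Nat.testBit_xor]
      · cases pz
        · simp [hj, fz]
        · simp [hj, fz, Nat.testBit_xor, testBit_two_pow_bitIdx]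
    · cases pz <;> simp [hr, fz]
  · intro c j; simp [hX]
  · intro c j; simp [hZ]

/-- Fault injection preserves the representation. -/
theorem Rel.inject (S : SMCode ℓ m) (f : Fault ℓ m) {st : State ℓ m} {s : WState} (h : Rel st s) :
    Rel (inject S f st) (injectW S f s) := by
  cases f with
  | cnot c lay i pc pt => exact (h.mulAt lay.ctrl i pc).mulAt lay.tgt (i + lay.mon S) pt
  | idle c sl i p => exact h.mulAt sl.reg i p
  | initX c i => exact h.mulAt .X i (false, true)
  | initZ c i => exact h.mulAt .Z i (true, false)
  | measX c i =>
    obtain ⟨fx, fz, hX, hZ⟩ := h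
    refine ⟨fx, fz, ?_, hZ⟩
    intro c' j
    simp only [_root_.Summit.Ventures.QEC.CircuitDistance.inject, injectW]
    by_cases hc : c' = c
    · subst hc
      by_cases hj : j = i
      · subst hj; simp [hX, Nat.testBit_xor]
      · simp [hj, hX, Nat.testBit_xor, testBit_two_pow_bitIdx]
    · simp [hc, hX]
  | measZ c i =>
    obtain ⟨fx, fz, hX, hZ⟩ := h
    refine ⟨fx, fz, hX, ?_⟩
    intro c' j
    simp only [_root_.Summit.Ventures.QEC.CircuitDistance.inject, injectW]
    by_cases hc : c' = c
    · subst hc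
      by_cases hj : j = i
      · subst hj; simp [hZ, Nat.testBit_xor]
      · simp [hj, hZ, Nat.testBit_xor, testBit_two_pow_bitIdx]
    · simp [hc, hZ]

/-- The whole simulation preserves the representation. -/
theorem Rel.simulate (S : SMCode ℓ m) (f : Fault ℓ m) (es : List Ev) {st : State ℓ m} {s : WState} (h : Rel st s) :
    Rel (simulate S f es st) (simulateW S f es s) := by
  induction es generalizing st s with
  | nil => exact h
  | cons e es ih =>
    simp only [_root_.Summit.Ventures.QEC.CircuitDistance.simulate, simulateW]
    apply ih
    by_cases he : e = f.ev
    · rw [if_pos he, if_pos he]; exact (h.applyEv S e).inject S f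
    · rw [if_neg he, if_neg he]; exact h.applyEv S e

/-- `runW` represents `run1`. -/
theorem rel_run (S : SMCode ℓ m) (Nc : ℕ) (f : Fault ℓ m) : Rel (run1 S Nc f) (runW S Nc f) :=
  Rel.init.simulate S f (allEvents Nc)

end Summit.Ventures.QEC.CircuitDistance
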